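import Summits.ValiantsHypothesis.ValiantsHypothesis.Theses.PolyaContinued
import Literature.Barriers.ValiantsHypothesis.MonotoneGapPermanentLower
import Summits.ValiantsHypothesis.ValiantsHypothesis.Theorems.PolyaContinuedPfaffianNormalForm
import Literature.Computability.AlgebraicComplexity.PermanentVsDeterminantProofs
import Summits.ValiantsHypothesis.ValiantsHypothesis.Theorems.PolyaContinuedMonotoneCoverHard
import Summits.ValiantsHypothesis.ValiantsHypothesis.Theorems.PolyaContinuedPfaffianCoverHardSplitGlue
import Summits.ValiantsHypothesis.ValiantsHypothesis.Theorems.PolyaContinuedLaplaceRigiditySupportsB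

/-!
# Line `laplace_rigidity` for crux `CoverDecancellation` (stmt-ValiantsHypothesis-17819, route PolyaContinued)

val-idea-10 g0, lens = STRENGTHEN.  S⁺ = LAPLACE RIGIDITY: the two-factor graded product rank of the
permanent is the Laplace number,
  `PR_k(per_n) := min { w : per_n = ∑_{i<w} p_i q_i, p_i homogeneous of degree k, q_i of degree n-k } = C(n,k)`,
and its central, logarithmic shadow `CentralLaplaceRigidity` (`n ≤ c (log₂ w + 1)` for any
`(⌊n/2⌋, ⌈n/2⌉)`-decomposition of width `w`), which is what the crux needs.

Skeleton: `stub_centralLaplaceRigidity` (THE BET, XL) → `stub_coverCut` (support, L: a complex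
Pfaffian cover of size `m` is an affine determinantal representation of size `m`, hence a
homogenised Mahajan–Vinay branching program with `≤ 2^{c₂(log₂ m+1)}` vertices, and cutting it at
degree `⌊n/2⌋` writes `per_n` as that many two-factor products) → `stub_zeroOneGrenet` (support, M:
Grenet's subset-lattice program, as the split-graph Pfaffian cover with a super-vertex, is a
0/1-labelled Pfaffian cover of `per_n` of size `2^n + 1 ≤ 2^(n+c₀)`) → `CoverDecancellation_of`
(kernel-checked below, exponent bookkeeping only).

Honest framing: `CoverDecancellation` is the RESIDUAL of the split `PfaffianCoverHard ⇐
MonotoneCoverHard ∧ CoverDecancellation` and is calibrated ≥ the summit (it forces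
`dc(per_n) ≥ 2^{n^{Ω(1)}}`); every S⁺ of it is therefore at least summit-hard, and this one says so
openly: `LaplaceRigidity ⇒ hom-ABP(per_n) ≥ C(n,⌊n/2⌋) ⇒ dc(per_n) ≥ 2^n / poly(n)`.  VP ≠ VNP is
not moved by this file.  What the strengthening BUYS is a single-cut algebraic law with decidable
small rungs ((n,k) = (4,2), (5,2), (6,3)), known at k = 1 (Chan–Ilten 2015, Prop. 2.6: PR_1(per_n)
= n), false for the determinant from k = 3 on (det ∈ VBP; and prk(det_4) = 3 < 6 = C(4,2),
arXiv:2509.06294 Thm 3), and provably tight among torus-equivariant decompositions (volume count).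
-/

-- single-conjunct layout: Sub = Summit, duplicated namespace component intended
set_option linter.dupNamespace false

namespace Summit.ValiantsHypothesis.ValiantsHypothesis.Cruxes.CoverDecancellation.LaplaceRigidity

open MvPolynomial
open scoped BigOperators

/-- A two-factor graded decomposition of the permanent of format `(k, n-k)` and width `w`:
`per_n = ∑_{i<w} p_i q_i` with `p_i` homogeneous of degree `k`, `q_i` homogeneous of degree `n-k`. -/
def IsTwoFactorDecomp (n k w : ℕ) (p q : Fin w → MvPolynomial (Fin n × Fin n) ℂ) : Prop :=
  (∀ i, (p i).IsHomogeneous k) ∧ (∀ i, (q i).IsHomogeneous (n - k)) ∧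
    Literature.Computability.AlgebraicComplexity.perPoly (Fin n) ℂ = ∑ i, p i * q i

/-- **S⁺ (exact form): LAPLACE RIGIDITY.** For `0 < k < n` every `(k, n-k)` two-factor
decomposition of `per_n` has width at least `C(n,k)` — the generalised Laplace expansion along `k`
rows is optimal.  Equivalently: `per_n` lies in no ideal generated by fewer than `C(n,k)` forms of
degree `k`.  Known for `k = 1` (and `k = n-1`): Chan–Ilten, ANT 9 (2015) Prop. 2.6.  False for
`det_n` (`k ≥ 3`, all large `n`). -/
def LaplaceRigidity : Prop :=
  ∀ n k w : ℕ, 0 < k → k < n → ∀ p q : Fin w → MvPolynomial (Fin n × Fin n) ℂ,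
    IsTwoFactorDecomp n k w p q → n.choose k ≤ w

/-- **S⁺ (central logarithmic form, the one the crux consumes).** Uniformly in `n`: a
`(⌊n/2⌋, ⌈n/2⌉)` two-factor decomposition of `per_n` of width `w` forces `n ≤ c (log₂ w + 1)`.
(`LaplaceRigidity` gives it with `c = 4` via `C(n,⌊n/2⌋) ≥ 2^{⌊n/2⌋}`.) -/
def CentralLaplaceRigidity : Prop :=
  ∃ c : ℕ, ∀ n w : ℕ, ∀ p q : Fin w → MvPolynomial (Fin n × Fin n) ℂ,
    IsTwoFactorDecomp n (n / 2) w p q → n ≤ c * (Nat.log 2 w + 1)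

/-- The hypothesis format of `CoverDecancellation`: a Pfaffian cover of `per_n` of size `m` with
COMPLEX constants (verbatim the inner format of `PfaffianCoverHard`). -/
def ComplexPfaffianCover (n m : ℕ) : Prop :=
  ∃ (E : Finset (Fin m × Fin m)) (P : MvPolynomial (Fin m × Fin m) ℂ),
    P = (Matrix.of fun i j => if (i, j) ∈ E then MvPolynomial.X (i, j) else 0 :
      Matrix (Fin m) (Fin m) (MvPolynomial (Fin m × Fin m) ℂ)).permanent ∧
    (∃ s : Fin m × Fin m → ℂ, (∀ e, s e = 1 ∨ s e = -1) ∧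
      (Matrix.of fun i j => if (i, j) ∈ E then MvPolynomial.C (s (i, j)) * MvPolynomial.X (i, j)
        else 0 : Matrix (Fin m) (Fin m) (MvPolynomial (Fin m × Fin m) ℂ)).det = P) ∧
    Literature.Computability.AlgebraicComplexity.IsProjection
      (Literature.Computability.AlgebraicComplexity.perPoly (Fin n) ℂ) P

/-- The conclusion format of `CoverDecancellation` (= `MonotoneCoverHard`'s): a Pfaffian cover of
`per_n` of size `m'` whose projection uses only the constants `0` and `1`. -/
def ZeroOnePfaffianCover (n m' : ℕ) : Prop :=
  ∃ (E' : Finset (Fin m' × Fin m')) (P' : MvPolynomial (Fin m' × Fin m') ℂ),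
    P' = (Matrix.of fun i j => if (i, j) ∈ E' then MvPolynomial.X (i, j) else 0 :
      Matrix (Fin m') (Fin m') (MvPolynomial (Fin m' × Fin m') ℂ)).permanent ∧
    (∃ s' : Fin m' × Fin m' → ℂ, (∀ e, s' e = 1 ∨ s' e = -1) ∧
      (Matrix.of fun i j => if (i, j) ∈ E' then MvPolynomial.C (s' (i, j)) * MvPolynomial.X (i, j)
        else 0 : Matrix (Fin m') (Fin m') (MvPolynomial (Fin m' × Fin m') ℂ)).det = P') ∧
    ∃ a : Fin m' × Fin m' → MvPolynomial (Fin n × Fin n) ℂ,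
      (∀ e, (∃ j, a e = MvPolynomial.X j) ∨ a e = 0 ∨ a e = 1) ∧
      Literature.Computability.AlgebraicComplexity.perPoly (Fin n) ℂ = MvPolynomial.aeval a P'

/-- The crux, unfolded into the two formats (definitional). -/
theorem coverDecancellation_iff :
    Summit.ValiantsHypothesis.ValiantsHypothesis.Theses.PolyaContinued.CoverDecancellation ↔
      ∃ c : ℕ, ∀ n m : ℕ, ComplexPfaffianCover n m →
        ∃ m' : ℕ, m' ≤ 2 ^ ((Nat.log 2 m + c) ^ c) ∧ ZeroOnePfaffianCover n m' :=
  Iff.rfl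

/-! ## Registered stubs -/

/-- **stub 1 — THE BET (crux-grade, XL): central Laplace rigidity.**  Why plausibly true: it is the
`k = ⌊n/2⌋` shadow of `LaplaceRigidity`, which holds at `k = 1` (Chan–Ilten 2015 Prop. 2.6), at
every torus-fixed decomposition (volume count: a `T`-homogeneous block `(R,C)` covers `k!(n-k)!`
permutations), for monotone decompositions, and matches every decided record (dc(per_3) = 7,
Grenet, LR15).  Why it might fail: a cancelling quadratic-type identity as for `det_4`
(prk(det_4) = 3, arXiv:2509.06294) could exist for `per_n`; known lower-bound tools stop at
`w ≳ codim Sing(per_n)/2 ≤ n` (Boralevi–Carlini–Michałek–Ventura 2025 + Kumar 2017). -/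
theorem stub_centralLaplaceRigidity : CentralLaplaceRigidity := by
  sorry

section Supports
/-! ## Stages 1–2: the two supports, now LANDED in `Theorems/` (p603490, p603823 — port of this
line's `Lines/laplace_rigidity_supports.lean`); here they are cited by name. -/

/-- **stub 2 — support (L): cutting a cover — PROVED (val-idea-10 g0).**  A complex Pfaffian cover of size `m` of `per_n` yields a
`(⌊n/2⌋, ⌈n/2⌉)` two-factor decomposition of width `≤ 2 (2 m³ + 2) ≤ 2^{6 (log₂ m + 1)}`:
cover ⇒ affine determinantal representation (`exists_affineDetRepr_of_cover`) ⇒ layered affine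
DAG on `2m³ + 2` vertices (`exists_dag_of_isAffineDetRepr`, Mahajan–Vinay) ⇒ homogeneous cut
at degree `⌊n/2⌋` (`homogeneous_cut`). [cite: MahajanVinay1997, §3; Nisan1991, §4] -/
theorem stub_coverCut :
    ∃ c₂ : ℕ, ∀ n m : ℕ, ComplexPfaffianCover n m →
      ∃ w : ℕ, w ≤ 2 ^ (c₂ * (Nat.log 2 m + 1)) ∧
        ∃ p q : Fin w → MvPolynomial (Fin n × Fin n) ℂ, IsTwoFactorDecomp n (n / 2) w p q := by
  obtain ⟨c₂, h⟩ := Summit.ValiantsHypothesis.ValiantsHypothesis.Theorems.PolyaContinuedLaplaceRigidity.Supports.coverCut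
  exact ⟨c₂, fun n m hc => h n m hc⟩

/-- **stub 3 — support (M): Grenet's cover is 0/1 — PROVED.**  Grenet's subset-lattice program
(arc `S → insert j S` labelled `X (j, |S|)`, tree: `Grenet.pow_succ_eq_zero`,
`Grenet.adjugate_one_sub_empty_univ`, `Grenet.sum_ite_injective`) read in at `∅` and out at `univ`
has value `per_n`; `exists_zeroOneCover_of_ranked` turns it into a 0/1 Pfaffian cover on
`2^n + 1 ≤ 2^(n+1)` + `2^n + 1` vertices. [cite: Grenet2011, Thm. 1] -/
theorem stub_zeroOneGrenet :
    ∃ c₀ : ℕ, ∀ n : ℕ, ∃ m' : ℕ, m' ≤ 2 ^ (n + c₀) ∧ ZeroOnePfaffianCover n m' := by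
  obtain ⟨c₀, h⟩ := Summit.ValiantsHypothesis.ValiantsHypothesis.Theorems.PolyaContinuedLaplaceRigidity.Supports.zeroOneGrenet
  exact ⟨c₀, fun n => h n⟩

end Supports

/-! ## The kernel-checked composition -/

/-- `2 ^ n`-type bookkeeping: from `n ≤ c (c₂ (L+1) + 1)` and `K = c c₂ + c + c₀ + 2` get
`n + c₀ ≤ (L + K) ^ K`. -/
theorem exponent_bound (c c₂ c₀ L n : ℕ) (hn : n ≤ c * (c₂ * (L + 1) + 1)) :
    n + c₀ ≤ (L + (c * c₂ + c + c₀ + 2)) ^ (c * c₂ + c + c₀ + 2) := by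
  set K := c * c₂ + c + c₀ + 2 with hK
  have hK2 : 2 ≤ K := by omega
  have h1 : n + c₀ ≤ K * L + K * K := by
    have hcc : c * c₂ ≤ K := by omega
    have hrest : c * c₂ + c + c₀ ≤ K := by omega
    have hKK : K ≤ K * K := Nat.le_mul_self K
    have hexp : c * (c₂ * (L + 1) + 1) = c * c₂ * L + (c * c₂ + c) := by ring
    calc n + c₀ ≤ c * c₂ * L + (c * c₂ + c) + c₀ := by omega
      _ ≤ K * L + K := by nlinarith [Nat.mul_le_mul_right L hcc]
      _ ≤ K * L + K * K := by omega
  calc n + c₀ ≤ K * L + K * K := h1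
    _ ≤ (L + K) * (L + K) := by nlinarith [Nat.zero_le L, Nat.zero_le K]
    _ = (L + K) ^ 2 := (sq (L + K)).symm
    _ ≤ (L + K) ^ K := Nat.pow_le_pow_right (by omega) hK2

/-- **`CoverDecancellation` from the three stubs** (conclusion = the route decl BY NAME). -/
theorem CoverDecancellation_of
    (h₁ : CentralLaplaceRigidity)
    (h₂ : ∃ c₂ : ℕ, ∀ n m : ℕ, ComplexPfaffianCover n m →
      ∃ w : ℕ, w ≤ 2 ^ (c₂ * (Nat.log 2 m + 1)) ∧
        ∃ p q : Fin w → MvPolynomial (Fin n × Fin n) ℂ, IsTwoFactorDecomp n (n / 2) w p q)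
    (h₃ : ∃ c₀ : ℕ, ∀ n : ℕ, ∃ m' : ℕ, m' ≤ 2 ^ (n + c₀) ∧ ZeroOnePfaffianCover n m') :
    Summit.ValiantsHypothesis.ValiantsHypothesis.Theses.PolyaContinued.CoverDecancellation := by
  rw [coverDecancellation_iff]
  obtain ⟨c, hc⟩ := h₁
  obtain ⟨c₂, hc₂⟩ := h₂
  obtain ⟨c₀, hc₀⟩ := h₃
  refine ⟨c * c₂ + c + c₀ + 2, fun n m hcov => ?_⟩
  obtain ⟨w, hw, p, q, hpq⟩ := hc₂ n m hcov
  obtain ⟨m', hm', hcov'⟩ := hc₀ n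
  refine ⟨m', hm'.trans (Nat.pow_le_pow_right Nat.two_pos ?_), hcov'⟩
  -- n ≤ c (log₂ w + 1) and log₂ w ≤ c₂ (log₂ m + 1)
  have hn : n ≤ c * (Nat.log 2 w + 1) := hc n w p q hpq
  have hlogw : Nat.log 2 w ≤ c₂ * (Nat.log 2 m + 1) := by
    calc Nat.log 2 w ≤ Nat.log 2 (2 ^ (c₂ * (Nat.log 2 m + 1))) := Nat.log_mono_right hw
      _ = c₂ * (Nat.log 2 m + 1) := Nat.log_pow Nat.one_lt_two _
  have hn' : n ≤ c * (c₂ * (Nat.log 2 m + 1) + 1) :=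
    hn.trans (Nat.mul_le_mul_left c (Nat.add_le_add_right hlogw 1))
  exact exponent_bound c c₂ c₀ (Nat.log 2 m) n hn'

/-- **CD ⇐ the central law alone (val-idea-10 g0).**  With stubs 2 and 3 proved in this file,
`CoverDecancellation` follows from `CentralLaplaceRigidity` by the kernel-checked composition. -/
theorem coverDecancellation_of_centralLaplaceRigidity (h : CentralLaplaceRigidity) :
    Summit.ValiantsHypothesis.ValiantsHypothesis.Theses.PolyaContinued.CoverDecancellation :=
  CoverDecancellation_of h stub_coverCut stub_zeroOneGrenet

section Summit
/-! ## What the law buys, kernel-checked: the parent crux and the summit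

`pfaffianCoverHard_of_centralLaplaceRigidity`: the law refutes quasi-polynomial complex Pfaffian
covers of `per_n` DIRECTLY (cut at degree `n/2` by `stub_coverCut`, compare widths at `n = 2^s`;
no decancellation, no Grenet) — i.e. the line sits equally on the parent crux `PfaffianCoverHard`
(stmt-7420).  `valiantsHypothesis_of_centralLaplaceRigidity`: through the route's own `closes`
with its three PROVED items (`MonotoneCoverHard_proof`, `pfaffianCoverHardSplitGlue_proof`,
`pfaffianNormalForm_proof`) and `coverDecancellation_of_centralLaplaceRigidity`, the law implies
the summit `VP ≠ VNP` — honest reading: the law is ≥ the summit (it gives `per ∉ VBP` with a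
`2^{Ω(n)}` bound), and this theorem only certifies the direction LAW ⇒ SUMMIT. -/

theorem sq_le_two_pow : ∀ j : ℕ, 4 ≤ j → j * j ≤ 2 ^ j := by
  intro j hj
  induction j, hj using Nat.le_induction with
  | base => norm_num
  | succ j hj ih =>
    have h2 : 2 * j + 1 ≤ j * j := by nlinarith
    calc (j + 1) * (j + 1) = j * j + (2 * j + 1) := by ring
      _ ≤ 2 ^ j + 2 ^ j := Nat.add_le_add ih (h2.trans ih)
      _ = 2 ^ (j + 1) := by rw [pow_succ]; ring

/-- Polylog loses to linear: for all `A`, `B` some power of two `n = 2^s` has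
`A (log₂ n + B)^B + A < n`. -/
theorem growth (A B : ℕ) : ∃ s : ℕ, A * (s + B) ^ B + A < 2 ^ s := by
  set j := B + A + 4 with hj
  refine ⟨2 ^ j, ?_⟩
  have hA : A < 2 ^ A := Nat.lt_two_pow_self
  have hj4 : 4 ≤ j := by omega
  have hsq := sq_le_two_pow j hj4
  -- (2^j + B)^B ≤ (2^(j+1))^B
  have hB : B ≤ 2 ^ j := by
    have : B < 2 ^ B := Nat.lt_two_pow_self
    have : 2 ^ B ≤ 2 ^ j := Nat.pow_le_pow_right (by norm_num) (by omega)
    omega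
  have h2j : 2 ^ (j + 1) = 2 ^ j + 2 ^ j := by ring
  have h2A : 2 ^ (A + 1) = 2 ^ A + 2 ^ A := by ring
  have h1 : (2 ^ j + B) ^ B ≤ 2 ^ ((j + 1) * B) := by
    calc (2 ^ j + B) ^ B ≤ (2 ^ (j + 1)) ^ B := Nat.pow_le_pow_left (by omega) B
      _ = 2 ^ ((j + 1) * B) := by rw [← pow_mul]
  -- A * X + A ≤ 2^(A+1) * X for X ≥ 1
  have h2 : A * (2 ^ j + B) ^ B + A ≤ 2 ^ (A + 1 + (j + 1) * B) := by
    have hX : 1 ≤ (2 ^ j + B) ^ B := Nat.one_le_pow _ _ (by positivity)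
    calc A * (2 ^ j + B) ^ B + A ≤ A * (2 ^ j + B) ^ B + A * (2 ^ j + B) ^ B := by
            have := Nat.le_mul_of_pos_right A hX; omega
      _ = (2 * A) * (2 ^ j + B) ^ B := by ring
      _ ≤ 2 ^ (A + 1) * 2 ^ ((j + 1) * B) :=
          Nat.mul_le_mul (by omega) h1
      _ = 2 ^ (A + 1 + (j + 1) * B) := by rw [← pow_add]
  have h3 : A + 1 + (j + 1) * B < 2 ^ j := by
    have : A + 1 + (j + 1) * B < j * j := by
      rw [hj]; nlinarith
    omega
  calc A * (2 ^ j + B) ^ B + A ≤ 2 ^ (A + 1 + (j + 1) * B) := h2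
    _ < 2 ^ (2 ^ j) := Nat.pow_lt_pow_right (by norm_num) h3

/-- **The central law refutes quasi-polynomial Pfaffian covers** (the parent crux
`PfaffianCoverHard`, stmt-7420), directly through the cut. -/
theorem pfaffianCoverHard_of_centralLaplaceRigidity (h : CentralLaplaceRigidity) :
    Summit.ValiantsHypothesis.ValiantsHypothesis.Theses.PolyaContinued.PfaffianCoverHard := by
  rintro ⟨c, hc⟩
  obtain ⟨c', hc'⟩ := h
  obtain ⟨c₂, hcut⟩ := stub_coverCut
  obtain ⟨s, hs⟩ := growth (c' * (c₂ + 1)) c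
  obtain ⟨m, hm, E, P, hP, hsg, hproj⟩ := hc (2 ^ s)
  obtain ⟨w, hw, p, q, hpq⟩ := hcut (2 ^ s) m ⟨E, P, hP, hsg, hproj⟩
  have h1 : 2 ^ s ≤ c' * (Nat.log 2 w + 1) := hc' (2 ^ s) w p q hpq
  have hlogn : Nat.log 2 (2 ^ s) = s := Nat.log_pow Nat.one_lt_two s
  have hlogm : Nat.log 2 m ≤ (s + c) ^ c := by
    have := Nat.log_mono_right (b := 2) hm
    rwa [Nat.log_pow Nat.one_lt_two, hlogn] at this
  have hlogw : Nat.log 2 w ≤ c₂ * (Nat.log 2 m + 1) := by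
    have := Nat.log_mono_right (b := 2) hw
    rwa [Nat.log_pow Nat.one_lt_two] at this
  set X := (s + c) ^ c with hX
  have h2 : Nat.log 2 w + 1 ≤ c₂ * (X + 1) + 1 := by
    have := Nat.mul_le_mul_left c₂ (Nat.add_le_add_right hlogm 1)
    omega
  have h3 : 2 ^ s ≤ c' * (c₂ * (X + 1) + 1) := h1.trans (Nat.mul_le_mul_left c' h2)
  have h4 : c' * (c₂ * (X + 1) + 1) ≤ c' * (c₂ + 1) * X + c' * (c₂ + 1) := by
    have := Nat.zero_le (c' * X)
    nlinarith
  omega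

/-- **The central law implies Valiant's hypothesis `VP ≠ VNP`** — via the route's `closes` and its
proved items.  (LAW ⇒ SUMMIT only; the law is at least summit-hard.) -/
theorem valiantsHypothesis_of_centralLaplaceRigidity (h : CentralLaplaceRigidity) :
    _root_.ValiantsHypothesis :=
  Summit.ValiantsHypothesis.ValiantsHypothesis.Theses.PolyaContinued.closes
    Summit.ValiantsHypothesis.ValiantsHypothesis.Theorems.PolyaContinuedMonotoneCoverHard.MonotoneCoverHard_proof
    (coverDecancellation_of_centralLaplaceRigidity h)
    Summit.ValiantsHypothesis.ValiantsHypothesis.Theorems.PolyaContinued.pfaffianCoverHardSplitGlue_proof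
    Summit.ValiantsHypothesis.ValiantsHypothesis.Theorems.PolyaContinued.pfaffianNormalForm_proof

end Summit

/-! ## Side facts recorded for the critics (statements only; not registered stubs) -/

/-- The exact law implies the central logarithmic form (arithmetic: `(n+1)·C(n,⌊n/2⌋) ≥ 2^n`);
PROVED below (`exactImpliesCentral`, `c = 4`) — the line's bet is filed in the weaker, central form. -/
def ExactImpliesCentral : Prop := LaplaceRigidity → CentralLaplaceRigidity

/-- arithmetic: `2 r ≤ 2^r`. -/
theorem two_mul_le_two_pow (r : ℕ) : 2 * r ≤ 2 ^ r := by
  induction r with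
  | zero => simp
  | succ r ih =>
    rcases Nat.eq_zero_or_pos r with rfl | hr
    · simp
    · have h2 : 2 ≤ 2 ^ r := by
        calc 2 = 2 ^ 1 := by norm_num
          _ ≤ 2 ^ r := Nat.pow_le_pow_right (by norm_num) hr
      calc 2 * (r + 1) = 2 * r + 2 := by ring
        _ ≤ 2 ^ r + 2 ^ r := by omega
        _ = 2 ^ (r + 1) := by ring

/-- the middle binomial coefficient carries a `1/(n+1)` fraction of `2^n`. -/
theorem two_pow_le_succ_mul_choose_middle (n : ℕ) : 2 ^ n ≤ (n + 1) * n.choose (n / 2) := by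
  calc 2 ^ n = ∑ m ∈ Finset.range (n + 1), n.choose m := (Nat.sum_range_choose n).symm
    _ ≤ ∑ m ∈ Finset.range (n + 1), n.choose (n / 2) :=
        Finset.sum_le_sum fun m _ => Nat.choose_le_middle m n
    _ = (n + 1) * n.choose (n / 2) := by simp [Finset.sum_const, Finset.card_range]

/-- **The exact law feeds the crux**: `LaplaceRigidity → CentralLaplaceRigidity` (with `c = 4`). -/
theorem exactImpliesCentral : ExactImpliesCentral := by
  intro hL
  refine ⟨4, fun n w p q hpq => ?_⟩
  rcases Nat.lt_or_ge n 2 with hn | hn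
  · omega
  have hk0 : 0 < n / 2 := by omega
  have hkn : n / 2 < n := by omega
  have hw : n.choose (n / 2) ≤ w := hL n (n / 2) w hk0 hkn p q hpq
  have h2n : 2 ^ n ≤ (n + 1) * w :=
    (two_pow_le_succ_mul_choose_middle n).trans (Nat.mul_le_mul_left _ hw)
  set L := Nat.log 2 w with hLdef
  have hwlt : w < 2 ^ (L + 1) := Nat.lt_pow_succ_log_self (by norm_num) w
  by_contra hcon
  push Not at hcon
  have key : (n + 1) * 2 ^ (L + 1) ≤ 2 ^ n := by
    have hsplit : 2 ^ n = 2 ^ (n - (L + 1)) * 2 ^ (L + 1) := by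
      rw [← pow_add]; congr 1; omega
    have h1 : n + 1 ≤ 2 * (n - (L + 1)) := by omega
    have h2 : 2 * (n - (L + 1)) ≤ 2 ^ (n - (L + 1)) := two_mul_le_two_pow _
    calc (n + 1) * 2 ^ (L + 1) ≤ 2 ^ (n - (L + 1)) * 2 ^ (L + 1) :=
          Nat.mul_le_mul_right _ (h1.trans h2)
      _ = 2 ^ n := hsplit.symm
  have hlt : (n + 1) * w < (n + 1) * 2 ^ (L + 1) := Nat.mul_lt_mul_of_pos_left hwlt (by omega)
  exact absurd (h2n.trans_lt hlt) (not_lt.mpr key)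

/-- The first open rung, decidable by computer algebra: `PR_2(per_4) = 6`, i.e. `per_4` is not a
sum of five products of two quadrics (for `det_4` three suffice, arXiv:2509.06294 Thm 3; four are
needed for `per_4` by `V(p,q) ⊆ Sing(per_4)`, `codim Sing(per_4) = 8`). -/
def RungFourTwo : Prop :=
  ∀ p q : Fin 5 → MvPolynomial (Fin 4 × Fin 4) ℂ, ¬ IsTwoFactorDecomp 4 2 5 p q

/-- PRICE P1 (crit-3 #5 / director 02:37:22Z): the (4,2) rung under the director's name —
«no (2,2)-decomposition of per₄ of width ≤ 5», i.e. `str_2(per_4) = 6`; alias of `RungFourTwo`;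
decidable over ℂ in principle, OPEN; to be banked as support r9 (0 width). -/
def StrengthTwoPerFour : Prop :=
  ∀ p q : Fin 5 → MvPolynomial (Fin 4 × Fin 4) ℂ, ¬ IsTwoFactorDecomp 4 2 5 p q

theorem strengthTwoPerFour_iff : StrengthTwoPerFour ↔ RungFourTwo := Iff.rfl

/-- PRICE P1, lower rung «str_2(per_4) ≥ 4»: no (2,2)-decomposition of per₄ of width 3 (det₄ HAS
one: arXiv:2509.06294 Thm 3). Provable now from GGIL22 Prop 6 (`V(p,q) ⊆ Sing(per₄)`,
`codim V(p,q) ≤ 6`) once `codim Sing(per₄) ≥ 7` is certified exactly (numerically 8, j297515). -/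
def StrengthTwoPerFourGeFour : Prop :=
  ∀ p q : Fin 3 → MvPolynomial (Fin 4 × Fin 4) ℂ, ¬ IsTwoFactorDecomp 4 2 3 p q

/-! ## Rungs R1, R2 — BOTH PROVED BELOW (kernel-checked); not registered stubs

Both are the law in a regime where cancellation is impossible (R1) or confined to torus blocks (R2);
both hold verbatim for `det_n` too, so they are witnesses that the DEFINITIONS bite, not per/det
separators — the separator is R3/R4 (see the card). -/

/-- all coefficients real and nonnegative (no cancellation possible in `Σ p_i q_i`). -/
def NonnegCoeffs {σ : Type*} (f : MvPolynomial σ ℂ) : Prop :=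
  ∀ m, (f.coeff m).im = 0 ∧ 0 ≤ (f.coeff m).re

/-- **R1 — monotone Laplace rigidity** (proved below: `monotoneLaplaceRigidity`). Proof sketch: no cancellation ⇒ every pair of support
monomials `a ∈ supp pᵢ`, `b ∈ supp qᵢ` multiplies to a permutation monomial ⇒ all `a ∈ supp pᵢ` are
partial permutations on one row set `Rᵢ` and one column set `Cᵢ` (read off any `b`) ⇒ `pᵢ qᵢ` only
produces permutations with `π(Rᵢ) = Cᵢ`, `k!(n-k)!` of them ⇒ `w · k!(n-k)! ≥ n!`. -/
def MonotoneLaplaceRigidity : Prop :=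
  ∀ n k w : ℕ, 0 < k → k < n → ∀ p q : Fin w → MvPolynomial (Fin n × Fin n) ℂ,
    (∀ i, NonnegCoeffs (p i)) → (∀ i, NonnegCoeffs (q i)) →
      IsTwoFactorDecomp n k w p q → n.choose k ≤ w

/-! ### Proof of R1 -/

/-- degree of a support monomial of a homogeneous polynomial -/
theorem degree_eq_of_isHomogeneous {σ : Type*} {φ : MvPolynomial σ ℂ} {k : ℕ}
    (h : φ.IsHomogeneous k) {d : σ →₀ ℕ} (hd : coeff d φ ≠ 0) : d.degree = k := by
  by_contra hne
  exact hd (h.coeff_eq_zero hne)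

/-- In a two-factor decomposition, every monomial of `per_n` is a sum `a + b` of support
monomials of some `pᵢ`, `qᵢ` (no positivity needed). -/
theorem support_subset_biUnion {n k w : ℕ} {p q : Fin w → MvPolynomial (Fin n × Fin n) ℂ}
    (h : IsTwoFactorDecomp n k w p q) :
    (Literature.Computability.AlgebraicComplexity.perPoly (Fin n) ℂ).support ⊆
      Finset.univ.biUnion fun i => Finset.image₂ (· + ·) (p i).support (q i).support := by
  classical
  intro m hm
  rw [mem_support_iff, h.2.2, coeff_sum] at hm
  obtain ⟨i, -, hi⟩ := Finset.exists_ne_zero_of_sum_ne_zero hm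
  rw [coeff_mul] at hi
  obtain ⟨x, hx, hxne⟩ := Finset.exists_ne_zero_of_sum_ne_zero hi
  rw [Finset.HasAntidiagonal.mem_antidiagonal] at hx
  refine Finset.mem_biUnion.2 ⟨i, Finset.mem_univ _, Finset.mem_image₂.2 ⟨x.1, ?_, x.2, ?_, hx⟩⟩
  · exact mem_support_iff.2 (left_ne_zero_of_mul hxne)
  · exact mem_support_iff.2 (right_ne_zero_of_mul hxne)

/-- No cancellation: with nonnegative real coefficients, `a ∈ supp pᵢ`, `b ∈ supp qᵢ` forces
`a + b ∈ mon(per_n)`. -/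
theorem add_mem_support {n k w : ℕ} {p q : Fin w → MvPolynomial (Fin n × Fin n) ℂ}
    (hp : ∀ i, NonnegCoeffs (p i)) (hq : ∀ i, NonnegCoeffs (q i))
    (h : IsTwoFactorDecomp n k w p q) (i : Fin w) {a b : Fin n × Fin n →₀ ℕ}
    (ha : a ∈ (p i).support) (hb : b ∈ (q i).support) :
    a + b ∈ (Literature.Computability.AlgebraicComplexity.perPoly (Fin n) ℂ).support := by
  classical
  rw [mem_support_iff] at ha hb ⊢
  rw [h.2.2]
  -- real parts
  have hre : (coeff (a + b) (∑ j, p j * q j)).re =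
      ∑ j, ∑ x ∈ Finset.HasAntidiagonal.antidiagonal (a + b), (coeff x.1 (p j)).re * (coeff x.2 (q j)).re := by
    rw [coeff_sum, Complex.re_sum]
    refine Finset.sum_congr rfl fun j _ => ?_
    rw [coeff_mul, Complex.re_sum]
    refine Finset.sum_congr rfl fun x _ => ?_
    rw [Complex.mul_re, (hp j x.1).1, (hq j x.2).1, mul_zero, sub_zero]
  have hapos : 0 < (coeff a (p i)).re := by
    rcases (hp i a).2.lt_or_eq with hlt | heq
    · exact hlt
    · exact absurd (Complex.ext heq.symm (by rw [(hp i a).1, Complex.zero_im])) ha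
  have hbpos : 0 < (coeff b (q i)).re := by
    rcases (hq i b).2.lt_or_eq with hlt | heq
    · exact hlt
    · exact absurd (Complex.ext heq.symm (by rw [(hq i b).1, Complex.zero_im])) hb
  set F : Fin w → (Fin n × Fin n →₀ ℕ) × (Fin n × Fin n →₀ ℕ) → ℝ :=
    fun j x => (coeff x.1 (p j)).re * (coeff x.2 (q j)).re with hF
  have hFnn : ∀ j x, 0 ≤ F j x := fun j x => mul_nonneg (hp j x.1).2 (hq j x.2).2
  have hab : ((a, b) : (Fin n × Fin n →₀ ℕ) × (Fin n × Fin n →₀ ℕ)) ∈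
      Finset.HasAntidiagonal.antidiagonal (a + b) :=
    Finset.HasAntidiagonal.mem_antidiagonal.2 rfl
  have h1 : F i (a, b) ≤ ∑ x ∈ Finset.HasAntidiagonal.antidiagonal (a + b), F i x :=
    Finset.single_le_sum (fun x _ => hFnn i x) hab
  have h2 : (∑ x ∈ Finset.HasAntidiagonal.antidiagonal (a + b), F i x) ≤
      ∑ j, ∑ x ∈ Finset.HasAntidiagonal.antidiagonal (a + b), F j x :=
    Finset.single_le_sum (f := fun j => ∑ x ∈ Finset.HasAntidiagonal.antidiagonal (a + b), F j x)
      (fun j _ => Finset.sum_nonneg fun x _ => hFnn j x) (Finset.mem_univ i)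
  have hFab : F i (a, b) = (coeff a (p i)).re * (coeff b (q i)).re := rfl
  intro h0
  have h3 : (coeff (a + b) (∑ j, p j * q j)).re = 0 := by rw [h0, Complex.zero_re]
  rw [hre] at h3
  have h4 : (∑ j, ∑ x ∈ Finset.HasAntidiagonal.antidiagonal (a + b), F j x) = 0 := h3
  rw [hFab] at h1
  linarith [mul_pos hapos hbpos]

/-- **R1 — monotone Laplace rigidity, PROVED** (rung; kernel-checked): the Jerrum–Snir block count
`JerrumSnir.card_mul_card_mul_card_le` (tree, `Literature/Barriers/ValiantsHypothesis/MonotoneGapPermanentLower.lean`)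
bounds each no-cancellation block by `k!(n-k)!` permutations; `n!` permutations must be covered. In
particular Grenet/Laplace is optimal among monotone `(k,n-k)`-decompositions for every `k`. -/
theorem monotoneLaplaceRigidity : MonotoneLaplaceRigidity := by
  classical
  intro n k w hk hkn p q hp hq h
  set per := Literature.Computability.AlgebraicComplexity.perPoly (Fin n) ℂ with hper
  -- each block holds at most k!(n-k)! permutations
  have hblock : ∀ i, (Finset.image₂ (· + ·) (p i).support (q i).support).card ≤
      k.factorial * (n - k).factorial := by
    intro i
    by_cases hA : (p i).support.Nonempty
    · by_cases hB : (q i).support.Nonempty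
      · obtain ⟨a, ha⟩ := hA
        obtain ⟨b, hb⟩ := hB
        have hdeg_a : a.degree = k := degree_eq_of_isHomogeneous (h.1 i) (mem_support_iff.1 ha)
        have hdeg_b : b.degree = n - k :=
          degree_eq_of_isHomogeneous (h.2.1 i) (mem_support_iff.1 hb)
        have hJS := (Literature.Barriers.ValiantsHypothesis.JerrumSnir.card_mul_card_mul_card_le ℂ
          (A := (p i).support) (B := (q i).support) (C := ({0} : Finset (Fin n × Fin n →₀ ℕ)))
          ha hb ⟨0, Finset.mem_singleton_self 0⟩ (fun a' ha' b' hb' c' hc' => by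
            rw [Finset.mem_singleton] at hc'
            rw [hc', add_zero]
            exact add_mem_support hp hq h i ha' hb')).1
        rw [Finset.card_singleton, mul_one, hdeg_a, hdeg_b, map_add, hdeg_a, hdeg_b,
          Nat.add_sub_cancel' hkn.le, Nat.sub_self, Nat.factorial_zero, mul_one] at hJS
        exact (Finset.card_image₂_le _ _ _).trans hJS
      · rw [Finset.not_nonempty_iff_eq_empty.1 hB, Finset.image₂_empty_right, Finset.card_empty]
        exact Nat.zero_le _
    · rw [Finset.not_nonempty_iff_eq_empty.1 hA, Finset.image₂_empty_left, Finset.card_empty]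
      exact Nat.zero_le _
  -- count
  have hcount : n.factorial ≤ w * (k.factorial * (n - k).factorial) := by
    calc n.factorial = per.support.card :=
          (Literature.Barriers.ValiantsHypothesis.JerrumSnir.card_support_perPoly ℂ).symm
      _ ≤ (Finset.univ.biUnion fun i => Finset.image₂ (· + ·) (p i).support (q i).support).card :=
          Finset.card_le_card (support_subset_biUnion h)
      _ ≤ ∑ i, (Finset.image₂ (· + ·) (p i).support (q i).support).card :=
          Finset.card_biUnion_le
      _ ≤ ∑ _i : Fin w, k.factorial * (n - k).factorial := Finset.sum_le_sum fun i _ => hblock i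
      _ = w * (k.factorial * (n - k).factorial) := by
          rw [Finset.sum_const, Finset.card_univ, Fintype.card_fin, smul_eq_mul]
  have hpos : 0 < k.factorial * (n - k).factorial :=
    Nat.mul_pos (Nat.factorial_pos _) (Nat.factorial_pos _)
  have hchoose : n.choose k * (k.factorial * (n - k).factorial) = n.factorial := by
    rw [← mul_assoc]; exact Nat.choose_mul_factorial_mul_factorial hkn.le
  exact Nat.le_of_mul_le_mul_right (hchoose ▸ hcount) hpos


/-- row-degree vector of a monomial in the matrix variables -/
def rowDeg {n : ℕ} (m : (Fin n × Fin n) →₀ ℕ) : Fin n → ℕ := fun i => ∑ j, m (i, j)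

/-- column-degree vector of a monomial in the matrix variables -/
def colDeg {n : ℕ} (m : (Fin n × Fin n) →₀ ℕ) : Fin n → ℕ := fun j => ∑ i, m (i, j)

/-- `f` is a weight vector for the row/column torus `T = (ℂˣ)ⁿ × (ℂˣ)ⁿ`: all monomials of its support
share the row-degree and column-degree vectors. -/
def IsTorusWeightVector {n : ℕ} (f : MvPolynomial (Fin n × Fin n) ℂ) : Prop :=
  ∀ m ∈ f.support, ∀ m' ∈ f.support, rowDeg m = rowDeg m' ∧ colDeg m = colDeg m'

/-- **R2 — torus-fixed Laplace rigidity** (proved below: `torusFixedLaplaceRigidity`; the volume count at `T`-fixed decompositions; cancellation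
inside a block `(R,C)` is allowed but cannot create permutations outside `{π : π(R) = C}`; every
permutation needs a used block among the `(R, π(R))`; each block holds `k!(n-k)!` permutations). -/
def TorusFixedLaplaceRigidity : Prop :=
  ∀ n k w : ℕ, 0 < k → k < n → ∀ p q : Fin w → MvPolynomial (Fin n × Fin n) ℂ,
    (∀ i, IsTorusWeightVector (p i)) → (∀ i, IsTorusWeightVector (q i)) →
      IsTwoFactorDecomp n k w p q → n.choose k ≤ w

/-! ### Proof of R2 -/

open Literature.Computability.AlgebraicComplexity in
/-- A monomial with all row counts and all column counts equal to `1` is a permutation monomial. -/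
theorem exists_permMonomial_eq_of_counts {n : ℕ} {m : Fin n × Fin n →₀ ℕ}
    (hr : ∀ r, rowCount m r = 1) (hc : ∀ c, colCount m c = 1) :
    ∃ σ : Equiv.Perm (Fin n), permMonomial σ = m := by
  classical
  -- entries are ≤ 1
  have hle : ∀ r c, m (r, c) ≤ 1 := fun r c => by
    rw [← hr r]
    exact Finset.single_le_sum (f := fun c' => m (r, c')) (fun _ _ => Nat.zero_le _)
      (Finset.mem_univ c)
  -- two nonzero entries in one row / one column are impossible
  have hrow2 : ∀ r c c', c ≠ c' → m (r, c) ≠ 0 → m (r, c') = 0 := by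
    intro r c c' hcc' h0
    by_contra h1
    have h2 : m (r, c) + m (r, c') ≤ ∑ x, m (r, x) := by
      have e : (∑ x ∈ ({c, c'} : Finset (Fin n)), m (r, x)) = m (r, c) + m (r, c') :=
        Finset.sum_pair hcc'
      rw [← e]
      exact Finset.sum_le_sum_of_subset_of_nonneg (Finset.subset_univ _) fun _ _ _ => Nat.zero_le _
    have h3 : ∑ x, m (r, x) = 1 := hr r
    omega
  have hcol2 : ∀ c r r', r ≠ r' → m (r, c) ≠ 0 → m (r', c) = 0 := by
    intro c r r' hrr' h0
    by_contra h1
    have h2 : m (r, c) + m (r', c) ≤ ∑ x, m (x, c) := by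
      have e : (∑ x ∈ ({r, r'} : Finset (Fin n)), m (x, c)) = m (r, c) + m (r', c) :=
        Finset.sum_pair hrr'
      rw [← e]
      exact Finset.sum_le_sum_of_subset_of_nonneg (Finset.subset_univ _) fun _ _ _ => Nat.zero_le _
    have h3 : ∑ x, m (x, c) = 1 := hc c
    omega
  -- the row of the nonzero entry of each column
  have hex : ∀ c, ∃ r, m (r, c) ≠ 0 := fun c => by
    have h1 : ∑ r, m (r, c) ≠ 0 := by rw [show ∑ r, m (r, c) = colCount m c from rfl, hc c]; omega
    obtain ⟨r, -, hr'⟩ := Finset.exists_ne_zero_of_sum_ne_zero h1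
    exact ⟨r, hr'⟩
  choose g hg using hex
  have hginj : Function.Injective g := fun c c' hcc' => by
    by_contra hne
    exact hg c' (by rw [← hcc']; exact hrow2 (g c) c c' hne (hg c))
  have hgbij : Function.Bijective g := (Finite.injective_iff_bijective).1 hginj
  refine ⟨Equiv.ofBijective g hgbij, Finsupp.ext fun rc => ?_⟩
  obtain ⟨r, c⟩ := rc
  rw [permMonomial_apply, Equiv.ofBijective_apply]
  split_ifs with hgc
  · subst hgc
    have := hle (g c) c
    have := hg c
    omega
  · exact (hcol2 c (g c) r hgc (hg c)).symm ▸ rfl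

open Literature.Computability.AlgebraicComplexity in
/-- **R2 — torus-fixed Laplace rigidity, PROVED** (rung; kernel-checked): if every `pᵢ`, `qᵢ` is a
weight vector of the row/column torus then `w ≥ C(n,k)` — the volume count at `T`-fixed
decompositions that the degeneration-defect mechanism starts from (cancellation inside a block is
allowed; a block meeting one permutation monomial consists of permutation monomials only). -/
theorem torusFixedLaplaceRigidity : TorusFixedLaplaceRigidity := by
  classical
  intro n k w hk hkn p q hp hq h
  set per := Literature.Computability.AlgebraicComplexity.perPoly (Fin n) ℂ with hper
  -- each block meets at most k!(n-k)! permutation monomials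
  have hblock : ∀ i, ((Finset.image₂ (· + ·) (p i).support (q i).support) ∩ per.support).card ≤
      k.factorial * (n - k).factorial := by
    intro i
    by_cases hex : ∃ a ∈ (p i).support, ∃ b ∈ (q i).support, a + b ∈ per.support
    · obtain ⟨a₀, ha₀, b₀, hb₀, hab₀⟩ := hex
      obtain ⟨σ₀, hσ₀⟩ := (Literature.Barriers.ValiantsHypothesis.JerrumSnir.mem_support_perPoly ℂ).1 hab₀
      -- all pairs of the block are permutation monomials
      have hall : ∀ a ∈ (p i).support, ∀ b ∈ (q i).support, a + b ∈ per.support := by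
        intro a ha b hb
        have hra : rowDeg a = rowDeg a₀ := (hp i a ha a₀ ha₀).1
        have hca : colDeg a = colDeg a₀ := (hp i a ha a₀ ha₀).2
        have hrb : rowDeg b = rowDeg b₀ := (hq i b hb b₀ hb₀).1
        have hcb : colDeg b = colDeg b₀ := (hq i b hb b₀ hb₀).2
        have hrow : ∀ r, rowCount (a + b) r = 1 := fun r => by
          have h1 : rowCount (a₀ + b₀) r = 1 := by rw [← hσ₀]; exact rowCount_permMonomial σ₀ r
          rw [rowCount_add] at h1 ⊢
          have e1 : rowCount a r = rowCount a₀ r := congrFun hra r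
          have e2 : rowCount b r = rowCount b₀ r := congrFun hrb r
          rw [e1, e2]; exact h1
        have hcol : ∀ c, colCount (a + b) c = 1 := fun c => by
          have h1 : colCount (a₀ + b₀) c = 1 := by rw [← hσ₀]; exact colCount_permMonomial σ₀ c
          rw [colCount_add] at h1 ⊢
          have e1 : colCount a c = colCount a₀ c := congrFun hca c
          have e2 : colCount b c = colCount b₀ c := congrFun hcb c
          rw [e1, e2]; exact h1
        obtain ⟨σ, hσ⟩ := exists_permMonomial_eq_of_counts hrow hcol
        exact (Literature.Barriers.ValiantsHypothesis.JerrumSnir.mem_support_perPoly ℂ).2 ⟨σ, hσ⟩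
      have hdeg_a : a₀.degree = k := degree_eq_of_isHomogeneous (h.1 i) (mem_support_iff.1 ha₀)
      have hdeg_b : b₀.degree = n - k :=
        degree_eq_of_isHomogeneous (h.2.1 i) (mem_support_iff.1 hb₀)
      have hJS := (Literature.Barriers.ValiantsHypothesis.JerrumSnir.card_mul_card_mul_card_le ℂ
        (A := (p i).support) (B := (q i).support) (C := ({0} : Finset (Fin n × Fin n →₀ ℕ)))
        ha₀ hb₀ ⟨0, Finset.mem_singleton_self 0⟩ (fun a' ha' b' hb' c' hc' => by
          rw [Finset.mem_singleton] at hc'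
          rw [hc', add_zero]
          exact hall a' ha' b' hb')).1
      rw [Finset.card_singleton, mul_one, hdeg_a, hdeg_b, map_add, hdeg_a, hdeg_b,
        Nat.add_sub_cancel' hkn.le, Nat.sub_self, Nat.factorial_zero, mul_one] at hJS
      exact ((Finset.card_le_card Finset.inter_subset_left).trans
        (Finset.card_image₂_le _ _ _)).trans hJS
    · push Not at hex
      have hempty : (Finset.image₂ (· + ·) (p i).support (q i).support) ∩ per.support = ∅ := by
        refine Finset.eq_empty_of_forall_notMem fun m hm => ?_
        rw [Finset.mem_inter, Finset.mem_image₂] at hm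
        obtain ⟨⟨a, ha, b, hb, rfl⟩, hm2⟩ := hm
        exact hex a ha b hb hm2
      rw [hempty, Finset.card_empty]
      exact Nat.zero_le _
  -- count
  have hsub : per.support ⊆ Finset.univ.biUnion fun i =>
      (Finset.image₂ (· + ·) (p i).support (q i).support) ∩ per.support := by
    intro m hm
    have hm' := support_subset_biUnion h hm
    rw [Finset.mem_biUnion] at hm' ⊢
    obtain ⟨i, hi, hmi⟩ := hm'
    exact ⟨i, hi, Finset.mem_inter.2 ⟨hmi, hm⟩⟩
  have hcount : n.factorial ≤ w * (k.factorial * (n - k).factorial) := by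
    calc n.factorial = per.support.card :=
          (Literature.Barriers.ValiantsHypothesis.JerrumSnir.card_support_perPoly ℂ).symm
      _ ≤ (Finset.univ.biUnion fun i =>
            (Finset.image₂ (· + ·) (p i).support (q i).support) ∩ per.support).card :=
          Finset.card_le_card hsub
      _ ≤ ∑ i, ((Finset.image₂ (· + ·) (p i).support (q i).support) ∩ per.support).card :=
          Finset.card_biUnion_le
      _ ≤ ∑ _i : Fin w, k.factorial * (n - k).factorial := Finset.sum_le_sum fun i _ => hblock i
      _ = w * (k.factorial * (n - k).factorial) := by
          rw [Finset.sum_const, Finset.card_univ, Fintype.card_fin, smul_eq_mul]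
  have hpos : 0 < k.factorial * (n - k).factorial :=
    Nat.mul_pos (Nat.factorial_pos _) (Nat.factorial_pos _)
  have hchoose : n.choose k * (k.factorial * (n - k).factorial) = n.factorial := by
    rw [← mul_assoc]; exact Nat.choose_mul_factorial_mul_factorial hkn.le
  exact Nat.le_of_mul_le_mul_right (hchoose ▸ hcount) hpos

end Summit.ValiantsHypothesis.ValiantsHypothesis.Cruxes.CoverDecancellation.LaplaceRigidity
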